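import Mathlib
import HarnessLib

/-!
# ζ(5) search — Families: the dual constant term EXTENDED to negative span exponents — the gap power-series ring,
# the ten span units, and the seven Plücker moves

HONEST FRAMING: systematic search; no irrationality claim unless certified.  Cell `pub-zeta5`, certifier 2
(cert-2 g8, 2026-08-22).  Identities in the power-series ring `ℤ[[r₁,…,r₅]]`; no conjecture node is used; nothing about
`ζ(5)`; no number of record moves.

WHAT.  In the gap coordinates `g₀,…,g₅` of the dual cell put `r_i = g_i/g_{i−1}` (`i = 1,…,5`; index `i−1` of `Fin 5`),
so `g_i = g₀ r₁⋯r_i` and every span `L_S = Σ_{w∈S} g_w` (S a set of consecutive gaps) is `g_{min S} · u_S` with the UNIT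
`u_S = 1 + r_{a+1} + r_{a+1}r_{a+2} + ⋯ ∈ ℤ[[r]]` (`uPoly`, ten spans `01, 012, 0123, 12, 12345, 23, 234, 2345, 45, 012345`,
indexed `0,…,9`).  For an INTEGER exponent vector `n ∈ ℤ¹⁰` the product `E(n) = ∏_S u_S^{n_S}` is a unit of `ℤ[[r]]`
(`E`, via `uUnit`), and `Phi`-type functionals `coeffZ c (E n)` (coefficient at an integer exponent vector, `0` off the
orthant) extend the polynomial coefficients `[g^B] ∏ L_S^{n_S}` (`n ≥ 0`) of P2 g6's `dualConstantTerm`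
(`Families/DualConstantTerm`; bridge filed separately) to all `n ∈ ℤ¹⁰`.
PROVED here: the seven three-term identities among the span units that are the images of the Pascal relations of
`Families/DualQPolynomial` under cert-2 g8's change of variables (plan `HOME/cert-2/g8/DEXACT12.md`):
  `u0123·u2345 = u23·u012345 + r₃r₄·u01·u45`   (Plücker `L0123·L2345 = L23·L012345 + L01·L45`),
  `u012345 = u0123 + r₁r₂r₃r₄·u45`              (`L012345 = L0123 + L45`),
  `u012·u23 = u0123 + r₃·u01`                   (`L012·L23 = g₂L0123 + g₃L01`),
  `u234·u45 = u2345 + r₅·u23`                   (`L234·L45 = g₄L2345 + g₅L23`),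
  `u12345·u01 = u012345 + r₂·u2345`             (`L12345·L01 = g₁L012345 + g₀L2345`),
  `u45 = 1 + r₅`,  `u01·u12 = u012 + r₂`        (`L45 = g₄+g₅`, `L01·L12 = g₁L012 + g₀g₂`),
and their consequences `E_move0 … E_move6` for the unit products `E(n)` at arbitrary `n ∈ ℤ¹⁰`, plus the coefficient
functional `coeffZ` (`coeffZ_add`, `coeffZ_X_mul`).
-/

noncomputable section

open MvPowerSeries Finset

namespace Summit.KontsevichZagierPeriods.Zeta5Search.Families.Cellular

namespace DualR

/-- The power-series ring `ℤ[[r₁,…,r₅]]` (variable `i` of `Fin 5` is `r_{i+1} = g_{i+1}/g_i`). -/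
abbrev S5 := MvPowerSeries (Fin 5) ℤ

/-- The variable `r_{i+1}` as a power series. -/
abbrev r (i : Fin 5) : S5 := MvPowerSeries.X i

/-- The ten span units `u_S = L_S / g_{min S}` in `r`-coordinates, spans indexed
`0:01, 1:012, 2:0123, 3:12, 4:12345, 5:23, 6:234, 7:2345, 8:45, 9:012345`. -/
def uPoly : Fin 10 → S5 :=
  ![1 + r 0, 1 + r 0 + r 0 * r 1, 1 + r 0 + r 0 * r 1 + r 0 * r 1 * r 2, 1 + r 1,
    1 + r 1 + r 1 * r 2 + r 1 * r 2 * r 3 + r 1 * r 2 * r 3 * r 4, 1 + r 2, 1 + r 2 + r 2 * r 3,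
    1 + r 2 + r 2 * r 3 + r 2 * r 3 * r 4, 1 + r 4,
    1 + r 0 + r 0 * r 1 + r 0 * r 1 * r 2 + r 0 * r 1 * r 2 * r 3 + r 0 * r 1 * r 2 * r 3 * r 4]

/-- The span unit number `0`, unfolded. -/
@[simp] theorem uPoly_0 : uPoly 0 = 1 + r 0 := rfl
/-- The span unit number `1`, unfolded. -/
@[simp] theorem uPoly_1 : uPoly 1 = 1 + r 0 + r 0 * r 1 := rfl
/-- The span unit number `2`, unfolded. -/
@[simp] theorem uPoly_2 : uPoly 2 = 1 + r 0 + r 0 * r 1 + r 0 * r 1 * r 2 := rfl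
/-- The span unit number `3`, unfolded. -/
@[simp] theorem uPoly_3 : uPoly 3 = 1 + r 1 := rfl
/-- The span unit number `4`, unfolded. -/
@[simp] theorem uPoly_4 : uPoly 4 = 1 + r 1 + r 1 * r 2 + r 1 * r 2 * r 3 + r 1 * r 2 * r 3 * r 4 := rfl
/-- The span unit number `5`, unfolded. -/
@[simp] theorem uPoly_5 : uPoly 5 = 1 + r 2 := rfl
/-- The span unit number `6`, unfolded. -/
@[simp] theorem uPoly_6 : uPoly 6 = 1 + r 2 + r 2 * r 3 := rfl
/-- The span unit number `7`, unfolded. -/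
@[simp] theorem uPoly_7 : uPoly 7 = 1 + r 2 + r 2 * r 3 + r 2 * r 3 * r 4 := rfl
/-- The span unit number `8`, unfolded. -/
@[simp] theorem uPoly_8 : uPoly 8 = 1 + r 4 := rfl
/-- The span unit number `9`, unfolded. -/
@[simp] theorem uPoly_9 :
    uPoly 9 = 1 + r 0 + r 0 * r 1 + r 0 * r 1 * r 2 + r 0 * r 1 * r 2 * r 3 + r 0 * r 1 * r 2 * r 3 * r 4 := rfl

/-- Every span unit has constant coefficient `1`. -/
theorem constantCoeff_uPoly (k : Fin 10) : constantCoeff (uPoly k) = ((1 : ℤˣ) : ℤ) := by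
  fin_cases k <;> simp [r]

/-- The span unit as a unit of `ℤ[[r]]`. -/
def uUnit (k : Fin 10) : S5ˣ :=
  ⟨uPoly k, invOfUnit (uPoly k) 1, mul_invOfUnit _ _ (constantCoeff_uPoly k),
    invOfUnit_mul _ _ (constantCoeff_uPoly k)⟩

/-- The underlying power series of the span unit. -/
@[simp] theorem val_uUnit (k : Fin 10) : ((uUnit k : S5ˣ) : S5) = uPoly k := rfl

/-- **`E(n) = ∏_S u_S^{n_S}`** for an integer exponent vector `n ∈ ℤ¹⁰` (a unit of `ℤ[[r]]`). -/
def E (n : Fin 10 → ℤ) : S5ˣ := ∏ k : Fin 10, uUnit k ^ n k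

/-- `E` is a homomorphism: `E(n + m) = E(n)·E(m)`. -/
theorem E_add (n m : Fin 10 → ℤ) : E (n + m) = E n * E m := by
  unfold E
  rw [← Finset.prod_mul_distrib]
  refine Finset.prod_congr rfl fun k _ => ?_
  rw [Pi.add_apply, zpow_add]

/-- The exponent vector `δ_k`. -/
def delta (k : Fin 10) : Fin 10 → ℤ := fun j => if j = k then 1 else 0

/-- `E(δ_k) = u_k`. -/
theorem E_delta (k : Fin 10) : E (delta k) = uUnit k := by
  unfold E delta
  rw [Finset.prod_eq_single k]
  · simp
  · intro j _ hj; rw [if_neg hj, zpow_zero]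
  · intro h; exact absurd (Finset.mem_univ k) h

/-- `E(n + δ_k) = E(n)·u_k` on the level of power series. -/
theorem E_add_delta_val (n : Fin 10 → ℤ) (k : Fin 10) :
    ((E (n + delta k) : S5ˣ) : S5) = (E n : S5) * uPoly k := by
  rw [E_add, E_delta, Units.val_mul, val_uUnit]

/-! ## The seven three-term identities among the span units (Plücker relations / span splits) -/

/-- `u0123·u2345 = u23·u012345 + r₃r₄·u01·u45`. -/
theorem uPoly_rel0 : uPoly 2 * uPoly 7 = uPoly 5 * uPoly 9 + r 2 * r 3 * (uPoly 0 * uPoly 8) := by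
  rw [uPoly_2, uPoly_7, uPoly_5, uPoly_9, uPoly_0, uPoly_8]; ring

/-- `u012345 = u0123 + r₁r₂r₃r₄·u45`. -/
theorem uPoly_rel1 : uPoly 9 = uPoly 2 + r 0 * r 1 * r 2 * r 3 * uPoly 8 := by
  rw [uPoly_9, uPoly_2, uPoly_8]; ring

/-- `u012·u23 = u0123 + r₃·u01`. -/
theorem uPoly_rel2 : uPoly 1 * uPoly 5 = uPoly 2 + r 2 * uPoly 0 := by
  rw [uPoly_1, uPoly_5, uPoly_2, uPoly_0]; ring

/-- `u234·u45 = u2345 + r₅·u23`. -/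
theorem uPoly_rel3 : uPoly 6 * uPoly 8 = uPoly 7 + r 4 * uPoly 5 := by
  rw [uPoly_6, uPoly_8, uPoly_7, uPoly_5]; ring

/-- `u12345·u01 = u012345 + r₂·u2345`. -/
theorem uPoly_rel4 : uPoly 4 * uPoly 0 = uPoly 9 + r 1 * uPoly 7 := by
  rw [uPoly_4, uPoly_0, uPoly_9, uPoly_7]; ring

/-- `u45 = 1 + r₅`. -/
theorem uPoly_rel5 : uPoly 8 = 1 + r 4 := by
  rw [uPoly_8]

/-- `u01·u12 = u012 + r₂`. -/
theorem uPoly_rel6 : uPoly 0 * uPoly 3 = uPoly 1 + r 1 := by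
  rw [uPoly_0, uPoly_3, uPoly_1]; ring

/-! ## The coefficient functional at an integer exponent vector -/

/-- The coefficient of `r^c` for an INTEGER exponent vector `c` (`0` if some `c_j < 0`). -/
def coeffZ (c : Fin 5 → ℤ) (φ : S5) : ℤ :=
  if ∀ j, 0 ≤ c j then MvPowerSeries.coeff (Finsupp.equivFunOnFinite.symm fun j => (c j).toNat) φ else 0

/-- The unit vector `e_k ∈ ℤ⁵`. -/
def cUnit (k : Fin 5) : Fin 5 → ℤ := fun j => if j = k then 1 else 0

/-- Additivity. -/
theorem coeffZ_add (c : Fin 5 → ℤ) (φ ψ : S5) : coeffZ c (φ + ψ) = coeffZ c φ + coeffZ c ψ := by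
  unfold coeffZ
  split_ifs <;> simp

/-- **Shift**: `[r^c](r_k · φ) = [r^{c − e_k}] φ` (both sides `0` off the orthant). -/
theorem coeffZ_X_mul (c : Fin 5 → ℤ) (k : Fin 5) (φ : S5) : coeffZ c (r k * φ) = coeffZ (c - cUnit k) φ := by
  unfold coeffZ r
  rw [MvPowerSeries.X_def, MvPowerSeries.coeff_monomial_mul]
  by_cases h : ∀ j, 0 ≤ c j
  · rw [if_pos h]
    by_cases hk : 1 ≤ c k
    · have h' : ∀ j, 0 ≤ (c - cUnit k) j := by
        intro j
        simp only [Pi.sub_apply, cUnit]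
        split_ifs with hj
        · subst hj; omega
        · have := h j; omega
      rw [if_pos h']
      have hs : Finsupp.single k 1 ≤ (Finsupp.equivFunOnFinite.symm fun j => (c j).toNat) := by
        rw [Finsupp.single_le_iff, Finsupp.coe_equivFunOnFinite_symm]
        omega
      rw [if_pos hs, one_mul]
      have hidx : (Finsupp.equivFunOnFinite.symm fun j => (c j).toNat) - Finsupp.single k 1 =
          Finsupp.equivFunOnFinite.symm fun j => ((c - cUnit k) j).toNat := by
        ext j
        simp only [Finsupp.coe_tsub, Pi.sub_apply, Finsupp.coe_equivFunOnFinite_symm, Finsupp.single_apply, cUnit]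
        by_cases hj : k = j
        · subst hj; simp only [if_true]; omega
        · rw [if_neg hj, if_neg (Ne.symm hj)]; omega
      rw [hidx]
    · have hs : ¬ Finsupp.single k 1 ≤ (Finsupp.equivFunOnFinite.symm fun j => (c j).toNat) := by
        rw [Finsupp.single_le_iff, Finsupp.coe_equivFunOnFinite_symm]
        omega
      rw [if_neg hs]
      have h' : ¬ ∀ j, 0 ≤ (c - cUnit k) j := by
        intro h'
        have := h' k
        simp only [Pi.sub_apply, cUnit, if_true] at this
        omega
      rw [if_neg h']
  · rw [if_neg h]
    have h' : ¬ ∀ j, 0 ≤ (c - cUnit k) j := by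
      intro h'
      apply h
      intro j
      have := h' j
      simp only [Pi.sub_apply, cUnit] at this
      split_ifs at this <;> omega
    rw [if_neg h']

/-- `[r^c] 1 = [c = 0]`. -/
theorem coeffZ_one (c : Fin 5 → ℤ) : coeffZ c 1 = if c = 0 then 1 else 0 := by
  unfold coeffZ
  by_cases h : ∀ j, 0 ≤ c j
  · rw [if_pos h, MvPowerSeries.coeff_one]
    by_cases hc : c = 0
    · subst hc
      rw [if_pos rfl, if_pos]
      ext j; simp
    · rw [if_neg hc, if_neg]
      intro h0
      apply hc
      funext j
      have hj := congrArg (fun f => f j) h0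
      simp only [Finsupp.coe_equivFunOnFinite_symm, Finsupp.coe_zero, Pi.zero_apply] at hj
      have := h j
      simp only [Pi.zero_apply]
      omega
  · rw [if_neg h, if_neg]
    rintro rfl
    exact h fun j => le_refl _

/-! ## The seven moves for the unit products `E(n)`, `n ∈ ℤ¹⁰` arbitrary -/

/-- Move 1: `E(n + δ0123 + δ2345) = E(n + δ23 + δ012345) + r₃r₄·E(n + δ01 + δ45)`. -/
theorem E_move0 (n : Fin 10 → ℤ) :
    ((E (n + delta 2 + delta 7) : S5ˣ) : S5) = (E (n + delta 5 + delta 9) : S5) + r 2 * r 3 * (E (n + delta 0 + delta 8) : S5) := by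
  simp only [E_add_delta_val]
  rw [mul_assoc, uPoly_rel0]
  ring

/-- Move 2: `E(n + δ012345) = E(n + δ0123) + r₁r₂r₃r₄·E(n + δ45)`. -/
theorem E_move1 (n : Fin 10 → ℤ) :
    ((E (n + delta 9) : S5ˣ) : S5) = (E (n + delta 2) : S5) + r 0 * r 1 * r 2 * r 3 * (E (n + delta 8) : S5) := by
  simp only [E_add_delta_val]
  rw [uPoly_rel1]
  ring

/-- Move 3: `E(n + δ012 + δ23) = E(n + δ0123) + r₃·E(n + δ01)`. -/
theorem E_move2 (n : Fin 10 → ℤ) :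
    ((E (n + delta 1 + delta 5) : S5ˣ) : S5) = (E (n + delta 2) : S5) + r 2 * (E (n + delta 0) : S5) := by
  simp only [E_add_delta_val]
  rw [mul_assoc, uPoly_rel2]
  ring

/-- Move 4: `E(n + δ234 + δ45) = E(n + δ2345) + r₅·E(n + δ23)`. -/
theorem E_move3 (n : Fin 10 → ℤ) :
    ((E (n + delta 6 + delta 8) : S5ˣ) : S5) = (E (n + delta 7) : S5) + r 4 * (E (n + delta 5) : S5) := by
  simp only [E_add_delta_val]
  rw [mul_assoc, uPoly_rel3]
  ring

/-- Move 5: `E(n + δ12345 + δ01) = E(n + δ012345) + r₂·E(n + δ2345)`. -/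
theorem E_move4 (n : Fin 10 → ℤ) :
    ((E (n + delta 4 + delta 0) : S5ˣ) : S5) = (E (n + delta 9) : S5) + r 1 * (E (n + delta 7) : S5) := by
  simp only [E_add_delta_val]
  rw [mul_assoc, uPoly_rel4]
  ring

/-- Move 6: `E(n + δ45) = E(n) + r₅·E(n)`. -/
theorem E_move5 (n : Fin 10 → ℤ) :
    ((E (n + delta 8) : S5ˣ) : S5) = (E n : S5) + r 4 * (E n : S5) := by
  simp only [E_add_delta_val]
  rw [uPoly_rel5]
  ring

/-- Move 7: `E(n + δ01 + δ12) = E(n + δ012) + r₂·E(n)`. -/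
theorem E_move6 (n : Fin 10 → ℤ) :
    ((E (n + delta 0 + delta 3) : S5ˣ) : S5) = (E (n + delta 1) : S5) + r 1 * (E n : S5) := by
  simp only [E_add_delta_val]
  rw [mul_assoc, uPoly_rel6]
  ring

end DualR

end Summit.KontsevichZagierPeriods.Zeta5Search.Families.Cellular
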